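import Summits.PneNP.PneNP.Theorems.SoloBlindCollapseReps
import Summits.PneNP.PneNP.Theorems.SoloBlindStringFamily
import HarnessLib

/-!
# Isolating hash families for canonical representatives, found in polynomial time (tool for THEOREM E♯)

Step 2 of the kernel form of THEOREM E♯ of the solo report.  Given the polynomial-time canonical
representative map `rep` of `SoloBlindCollapseReps.lean`, the short NAME of a class will be
`(j, h_j(rep))` for a Sipser-style family `h_0, …, h_{k-1}` of linear hash functions
`{0,1}ⁱ → {0,1}ᵏ` that ISOLATES every representative of length `i` (`SoloBlindStringHash.lean`,
`SoloBlindStringFamily.lean`: such a family, coded by one string `w` of length `k²·i`, exists as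
soon as `2·#reps ≤ 2ᵏ`).  Here:

* `CHash.isolSet`, `CHash.sepSet`, `CHash.hashable` — "`y` is isolated by matrix `j` of `w`",
  "`w` separates all representatives of length `i`", "some `w` of length `≤ k²i` does" — and their
  polynomial-time tests on `1ᴺ`-padded codes under `NP ⊆ P` (`Collapse.polyForall/polyExists`);
* `CHash.kStar rep N i` — the least hashable `k`; `kStar ≤ i + 1`, and `kStar ≤ M + 1` whenever the
  length-`i` prefixes meet at most `2ᴹ` classes; `CHash.exists_kStarFn` — `kStar` is polynomial-time
  computable (least-witness search, `Collapse.search`);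
* `CHash.exists_wStar` — a polynomial-time choice of a separating string `w⋆(N, i)` for `kStar`;
* `CHash.exists_jS` — a polynomial-time isolating index `j(N, y) < kStar` for every representative.

All statements proved; hypotheses displayed (`NP ⊆ P`, a polynomial-time canonical `rep`).

References: M. Sipser, *A complexity theoretic approach to randomness*, STOC 1983 (coding lemma);
S. Arora, B. Barak, *Computational Complexity: A Modern Approach*, CUP 2009, Thm. 2.18, §5.2.
-/

namespace Summit.PneNP.PneNP.Theorems.SoloBlind

open Polynomial
open Literature.Computability.Complexity
open Literature.Computability.Complexity.CodeFP (natE unE bitE pairE rawE strE pairE_apply length_unE)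

namespace CHash

variable {L : Language Bool} {rep : ℕ → List Bool → List Bool}

/-! ### Isolation, separation, hashability -/

/-- The words `y` ISOLATED among the canonical representatives of length `i` by the `j`-th hash
matrix of the family coded by `w` (`k` functions `{0,1}ⁱ → {0,1}ᵏ`). [Sipser 1983] [folklore] -/
def isolSet (rep : ℕ → List Bool → List Bool) (N i k : ℕ) (w : List Bool) (j : ℕ) : Set (List Bool) :=
  {y | ∀ z : List Bool, z.length = i ∧ rep N z = z → z ≠ y →
    StrHash.shash (StrFam.mat k i w j) z ≠ StrHash.shash (StrFam.mat k i w j) y}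

/-- The family strings `w` SEPARATING the canonical representatives of length `i`: every
representative is isolated by one of the `k` matrices. [Sipser 1983] [folklore] -/
def sepSet (rep : ℕ → List Bool → List Bool) (N i k : ℕ) : Set (List Bool) :=
  {w | ∀ y : List Bool, y.length = i ∧ rep N y = y → ∃ j < k, y ∈ isolSet rep N i k w j}

/-- The HASHABLE lengths `k`: some family string of length `≤ k²·i` separates. [folklore] -/
def hashable (rep : ℕ → List Bool → List Bool) (N i : ℕ) : Set ℕ :=
  {k | ∃ w : List Bool, w.length ≤ k * k * i ∧ w ∈ sepSet rep N i k}

/-- Length of the padded context code `⟨1ᴺ, 1ⁱ, 1ᵏ, w⟩`. [folklore] -/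
theorem le_length_ctx (N i k : ℕ) (w : List Bool) :
    N + i + k + w.length ≤ (pairE unE (pairE unE (pairE unE strE)) (N, i, k, w)).length := by
  simp only [pairE_apply, length_boolPair, length_unE, CodeFP.strE, id_eq]
  omega

/-- Reading of the inner Boolean test of isolation. [folklore] -/
theorem isolInner_iff (a b c : Bool) : (!(a && !b) || !c) = true ↔ (a = true → b = false → c = false) := by
  revert a b c
  decide

open scoped Classical in
/-- **Isolation is a polynomial-time test** under `NP ⊆ P` (on codes `⟨⟨⟨1ᴺ,1ⁱ,1ᵏ,w⟩, y⟩, j⟩`).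
[cite: AroraBarak2009, Thm. 5.4 and §5.2] -/
theorem codeFP_isol (hNP : Nondeterministic.NP ⊆ Classes.P)
    (hrepC : CodeFP (pairE unE strE) strE (fun a => rep a.1 a.2)) :
    CodeFP (pairE (pairE (pairE unE (pairE unE (pairE unE strE))) strE) natE) bitE
      (fun c => decide (c.1.2 ∈ isolSet rep c.1.1.1 c.1.1.2.1 c.1.1.2.2.1 c.1.1.2.2.2 c.2)) := by
  -- codes of `(c, z)`
  have hc := CodeFP.fst (pairE (pairE (pairE unE (pairE unE (pairE unE strE))) strE) natE) strE
  have hz := CodeFP.snd (pairE (pairE (pairE unE (pairE unE (pairE unE strE))) strE) natE) strE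
  have hN := hc.fst'.fst'.fst'
  have hi := hc.fst'.fst'.snd'.fst'
  have hk := hc.fst'.fst'.snd'.snd'.fst'
  have hw := hc.fst'.fst'.snd'.snd'.snd'
  have hy := hc.fst'.snd'
  have hj := hc.snd'
  have hrep := (CReps.codeFP_isRep hrepC).comp (hN.pair (hi.pair hz))
  have hzy := (CodeFP.beq (eα := strE) Function.injective_id).comp (hz.pair hy)
  have hM := StrFam.codeFP_mat.comp (hk.pair (hi.pair (hw.pair hj)))
  have hsz := StrHash.codeFP_shash.comp (hM.pair hz)
  have hsy := StrHash.codeFP_shash.comp (hM.pair hy)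
  have hheq := (CodeFP.beq (eα := strE) Function.injective_id).comp (hsz.pair hsy)
  have hinner := (hrep.and hzy.not).not.or hheq.not
  refine (Collapse.polyForall hNP hinner X).congr fun c => decide_eq_decide.mpr ?_
  obtain ⟨⟨⟨N, i, k, w⟩, y⟩, j⟩ := c
  simp only [isolSet, Set.mem_setOf_eq]
  constructor
  · intro h z hz hne
    have hb : z.length ≤ X.eval (pairE (pairE (pairE unE (pairE unE (pairE unE strE))) strE) natE
        (((N, i, k, w), y), j)).length := by
      simp only [eval_X, pairE_apply, length_boolPair, length_unE, CodeFP.strE, id_eq]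
      omega
    have h' := (isolInner_iff _ _ _).1 (h z hb) (decide_eq_true hz) (beq_eq_false_iff_ne.2 hne)
    exact beq_eq_false_iff_ne.1 h'
  · intro h z _
    refine (isolInner_iff _ _ _).2 fun hz hne => beq_eq_false_iff_ne.2 ?_
    exact h z (of_decide_eq_true hz) (beq_eq_false_iff_ne.1 hne)

open scoped Classical in
/-- **Separation is a polynomial-time test** under `NP ⊆ P` (on codes `⟨1ᴺ,1ⁱ,1ᵏ,w⟩`).
[cite: AroraBarak2009, Thm. 5.4 and §5.2] -/
theorem codeFP_sep (hNP : Nondeterministic.NP ⊆ Classes.P)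
    (hrepC : CodeFP (pairE unE strE) strE (fun a => rep a.1 a.2)) :
    CodeFP (pairE unE (pairE unE (pairE unE strE))) bitE
      (fun c => decide (c.2.2.2 ∈ sepSet rep c.1 c.2.1 c.2.2.1)) := by
  have hc := CodeFP.fst (pairE unE (pairE unE (pairE unE strE))) strE
  have hy := CodeFP.snd (pairE unE (pairE unE (pairE unE strE))) strE
  have hN := hc.fst'
  have hi := hc.snd'.fst'
  have hk := hc.snd'.snd'.fst'
  have hrep := (CReps.codeFP_isRep hrepC).comp (hN.pair (hi.pair hy))
  have hany : CodeFP (pairE (pairE unE (pairE unE (pairE unE strE))) strE) bitE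
      (fun q => (List.range q.1.2.2.1).any fun j =>
        decide (q.2 ∈ isolSet rep q.1.1 q.1.2.1 q.1.2.2.1 q.1.2.2.2 j)) :=
    (CodeFP.any (codeFP_isol hNP hrepC)).comp ((CodeFP.id _).pair (CodeFP.urange.comp hk))
  have hinner := hrep.not.or hany
  refine (Collapse.polyForall hNP hinner X).congr fun c => decide_eq_decide.mpr ?_
  obtain ⟨N, i, k, w⟩ := c
  simp only [sepSet, Set.mem_setOf_eq]
  have key : ∀ y : List Bool, ((!decide (y.length = i ∧ rep N y = y)) ||
      (List.range k).any fun j => decide (y ∈ isolSet rep N i k w j)) = true ↔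
      (y.length = i ∧ rep N y = y → ∃ j < k, y ∈ isolSet rep N i k w j) := by
    intro y
    rw [Bool.or_eq_true, Bool.not_eq_true', decide_eq_false_iff_not, List.any_eq_true,
      ← imp_iff_not_or]
    simp only [List.mem_range, decide_eq_true_eq]
  constructor
  · intro h y hy
    have hb : y.length ≤ X.eval (pairE unE (pairE unE (pairE unE strE)) (N, i, k, w)).length := by
      have := le_length_ctx N i k w
      rw [eval_X]
      omega
    exact (key y).1 (h y hb) hy
  · intro h y _
    exact (key y).2 (h y)

/-- `((X+1)^3).eval n = (n+1)^3`. [folklore] -/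
theorem eval_cube (n : ℕ) : ((X + 1) ^ 3 : Polynomial ℕ).eval n = (n + 1) ^ 3 := by
  simp [eval_pow, eval_add, eval_X, eval_one]

/-- `k, i ≤ n ⟹ k²·i ≤ (n+1)³`. [folklore] -/
theorem kki_le_cube {k i n : ℕ} (hk : k ≤ n) (hi : i ≤ n) : k * k * i ≤ (n + 1) ^ 3 :=
  calc k * k * i ≤ n * n * n := Nat.mul_le_mul (Nat.mul_le_mul hk hk) hi
    _ = n ^ 3 := by ring
    _ ≤ (n + 1) ^ 3 := Nat.pow_le_pow_left (Nat.le_succ n) 3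

open scoped Classical in
/-- **Hashability is a polynomial-time test** under `NP ⊆ P` (on codes `⟨1ᴺ,1ⁱ,1ᵏ⟩`).
[cite: AroraBarak2009, Thm. 2.18, Thm. 5.4] -/
theorem codeFP_hashable (hNP : Nondeterministic.NP ⊆ Classes.P)
    (hrepC : CodeFP (pairE unE strE) strE (fun a => rep a.1 a.2)) :
    CodeFP (pairE unE (pairE unE unE)) bitE (fun c => decide (c.2.2 ∈ hashable rep c.1 c.2.1)) := by
  have hc := CodeFP.fst (pairE unE (pairE unE unE)) strE
  have hw := CodeFP.snd (pairE unE (pairE unE unE)) strE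
  have hN := hc.fst'
  have hi := hc.snd'.fst'
  have hk := hc.snd'.snd'
  have hsep := (codeFP_sep hNP hrepC).comp (hN.pair (hi.pair (hk.pair hw)))
  have hkN := CodeFP.natOfUn.comp hk
  have hlen : CodeFP (pairE (pairE unE (pairE unE unE)) strE) bitE
      (fun t => decide (t.2.length ≤ t.1.2.2 * t.1.2.2 * t.1.2.1)) :=
    CodeFP.natLe.comp ((CodeFP.strNatLength.comp hw).pair (CodeFP.natMul.comp
      ((CodeFP.natMul.comp (hkN.pair hkN)).pair (CodeFP.natOfUn.comp hi))))
  refine (Collapse.polyExists hNP (hlen.and hsep) ((X + 1) ^ 3)).congr fun c =>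
    decide_eq_decide.mpr ?_
  obtain ⟨N, i, k⟩ := c
  simp only [hashable, Set.mem_setOf_eq, Bool.and_eq_true, decide_eq_true_eq]
  constructor
  · rintro ⟨w, -, hwl, hws⟩
    exact ⟨w, hwl, hws⟩
  · rintro ⟨w, hwl, hws⟩
    refine ⟨w, hwl.trans ?_, hwl, hws⟩
    rw [eval_cube]
    have : i + k ≤ (pairE unE (pairE unE unE) (N, i, k)).length := by
      simp only [pairE_apply, length_boolPair, length_unE]
      omega
    exact kki_le_cube (by omega) (by omega)

/-! ### Hashable lengths exist: the least one, `kStar` -/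

/-- **Sipser's coding lemma, applied**: if `2·|repSet rep N i| ≤ 2ᵏ` then `k` is hashable.
[Sipser 1983, coding lemma] -/
theorem hashable_of_card {N i k : ℕ} (hcard : 2 * (CReps.repSet rep N i).card ≤ 2 ^ k) :
    k ∈ hashable rep N i := by
  obtain ⟨w, hwlen, hsep⟩ :=
    StrFam.exists_sepString (X := CReps.repSet rep N i) CReps.length_of_mem_repSet hcard
  refine ⟨w, hwlen.le, fun y hy => ?_⟩
  obtain ⟨j, hj, hiso⟩ := hsep y (CReps.mem_repSet.2 hy)
  exact ⟨j, hj, fun z hz hne => hiso z (CReps.mem_repSet.2 hz) hne⟩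

/-- `i + 1` is always hashable (`#reps ≤ 2ⁱ`). [folklore] -/
theorem succ_mem_hashable (rep : ℕ → List Bool → List Bool) (N i : ℕ) : i + 1 ∈ hashable rep N i :=
  hashable_of_card (by rw [pow_succ']; exact Nat.mul_le_mul_left 2 (CReps.card_repSet_le_two_pow rep N i))

/-- **Class-count bound on hashability**: if `rep` is canonical and the length-`i` prefixes meet at
most `2ᴹ` classes (witnessed by a cover `R`), then `M + 1` is hashable. [folklore] -/
theorem mem_hashable_of_cover {N i M : ℕ}
    (hR2 : ∀ N p p', p' ∈ NerodeStream.cls L N p → rep N p' = rep N p)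
    {R : Finset (List Bool)} (hRc : R.card ≤ 2 ^ M)
    (hcov : ∀ p : List Bool, p.length = i → ∃ r ∈ R, r ∈ NerodeStream.cls L N p) :
    M + 1 ∈ hashable rep N i :=
  hashable_of_card (by
    rw [pow_succ']
    exact Nat.mul_le_mul_left 2 ((CReps.card_repSet_le_of_cover hR2 hcov).trans hRc))

open scoped Classical in
/-- The least hashable length `k⋆(N, i)`. [folklore] -/
noncomputable def kStar (rep : ℕ → List Bool → List Bool) (N i : ℕ) : ℕ :=
  Nat.find (⟨i + 1, succ_mem_hashable rep N i⟩ : ∃ k, k ∈ hashable rep N i)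

open scoped Classical in
/-- `k⋆` is hashable. [folklore] -/
theorem kStar_mem (rep : ℕ → List Bool → List Bool) (N i : ℕ) : kStar rep N i ∈ hashable rep N i := by
  unfold kStar
  exact Nat.find_spec _

open scoped Classical in
/-- `k⋆` is the least hashable length. [folklore] -/
theorem kStar_le {N i k : ℕ} (hk : k ∈ hashable rep N i) : kStar rep N i ≤ k := by
  unfold kStar
  exact Nat.find_min' _ hk

/-- Nothing below `k⋆` is hashable. [folklore] -/
theorem not_mem_of_lt_kStar {N i k : ℕ} (hk : k < kStar rep N i) : k ∉ hashable rep N i :=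
  fun h => absurd (kStar_le h) (not_le.2 hk)

/-- `k⋆ ≤ i + 1`. [folklore] -/
theorem kStar_le_succ (rep : ℕ → List Bool → List Bool) (N i : ℕ) : kStar rep N i ≤ i + 1 :=
  kStar_le (succ_mem_hashable rep N i)

/-- **`k⋆ ≤ M + 1` under a `2ᴹ` class cover** (canonical `rep`). [folklore] -/
theorem kStar_le_of_cover {N i M : ℕ}
    (hR2 : ∀ N p p', p' ∈ NerodeStream.cls L N p → rep N p' = rep N p)
    {R : Finset (List Bool)} (hRc : R.card ≤ 2 ^ M)
    (hcov : ∀ p : List Bool, p.length = i → ∃ r ∈ R, r ∈ NerodeStream.cls L N p) :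
    kStar rep N i ≤ M + 1 :=
  kStar_le (mem_hashable_of_cover hR2 hRc hcov)

/-! ### `k⋆` and a separating string are polynomial-time computable -/

open scoped Classical in
/-- **`k⋆` is polynomial time** under `NP ⊆ P` (least-witness search over unary witnesses), in
unary on codes `⟨1ᴺ, 1ⁱ⟩`. [cite: AroraBarak2009, Thm. 2.18, Thm. 5.4] -/
theorem codeFP_kStar (hNP : Nondeterministic.NP ⊆ Classes.P)
    (hrepC : CodeFP (pairE unE strE) strE (fun a => rep a.1 a.2)) :
    CodeFP (pairE unE unE) unE (fun a => kStar rep a.1 a.2) := by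
  -- context `((N, i), u)`, witness `u'`
  have hc := CodeFP.fst (pairE unE unE) strE
  have hu := CodeFP.snd (pairE unE unE) strE
  have hH : CodeFP (pairE (pairE unE unE) strE) bitE
      (fun t => decide (t.2.length ∈ hashable rep t.1.1 t.1.2)) :=
    (codeFP_hashable hNP hrepC).comp (hc.fst'.pair (hc.snd'.pair (CodeFP.strLength.comp hu)))
  have hc₂ := CodeFP.fst (pairE (pairE unE unE) strE) strE
  have hu' := CodeFP.snd (pairE (pairE unE unE) strE) strE
  have hH' : CodeFP (pairE (pairE (pairE unE unE) strE) strE) bitE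
      (fun t => decide (t.2.length ∈ hashable rep t.1.1.1 t.1.1.2)) :=
    (codeFP_hashable hNP hrepC).comp (hc₂.fst'.fst'.pair (hc₂.fst'.snd'.pair
      (CodeFP.strLength.comp hu')))
  have hlt : CodeFP (pairE (pairE (pairE unE unE) strE) strE) bitE
      (fun t => decide (t.2.length < t.1.2.length)) :=
    CodeFP.natLt.comp ((CodeFP.strNatLength.comp hu').pair (CodeFP.strNatLength.comp hc₂.snd'))
  have hmin := Collapse.polyForall hNP (hlt.not.or hH'.not) X
  obtain ⟨g, hgC, hgood, -⟩ := Collapse.search hNP (hH.and hmin) X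
  have hread : ∀ (a : ℕ × ℕ) (u : List Bool), (decide (u.length ∈ hashable rep a.1 a.2) &&
      decide (∀ y : List Bool, y.length ≤ X.eval (pairE (pairE unE unE) strE (a, u)).length →
        (!decide (y.length < u.length) || !decide (y.length ∈ hashable rep a.1 a.2)) = true)) = true ↔
      (u.length ∈ hashable rep a.1 a.2 ∧ ∀ y : List Bool,
        y.length ≤ X.eval (pairE (pairE unE unE) strE (a, u)).length → y.length < u.length →
          y.length ∉ hashable rep a.1 a.2) := by
    intro a u
    simp only [Bool.and_eq_true, decide_eq_true_eq, Bool.or_eq_true, Bool.not_eq_true',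
      decide_eq_false_iff_not, ← imp_iff_not_or]
  have hk : ∀ a : ℕ × ℕ, (g a).length = kStar rep a.1 a.2 := by
    intro a
    have hex : ∃ u : List Bool, u.length ≤ X.eval (pairE unE unE a).length ∧
        (decide (u.length ∈ hashable rep a.1 a.2) && decide (∀ y : List Bool,
          y.length ≤ X.eval (pairE (pairE unE unE) strE (a, u)).length →
          (!decide (y.length < u.length) || !decide (y.length ∈ hashable rep a.1 a.2)) = true)) =
          true := by
      refine ⟨List.replicate (kStar rep a.1 a.2) true, ?_, (hread _ _).2 ⟨?_, fun y _ hy => ?_⟩⟩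
      · simp only [List.length_replicate, eval_X, pairE_apply, length_boolPair, length_unE]
        have := kStar_le_succ rep a.1 a.2
        omega
      · rw [List.length_replicate]
        exact kStar_mem rep a.1 a.2
      · rw [List.length_replicate] at hy
        exact not_mem_of_lt_kStar hy
    obtain ⟨hmem, hmin'⟩ := (hread _ _).1 (hgood a hex).2
    refine le_antisymm (not_lt.1 fun hlt' => ?_) (kStar_le hmem)
    refine hmin' (List.replicate (kStar rep a.1 a.2) true) ?_ (by rwa [List.length_replicate])
      (by rw [List.length_replicate]; exact kStar_mem rep a.1 a.2)
    rw [List.length_replicate, eval_X, pairE_apply, length_boolPair]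
    simp only [CodeFP.strE, id_eq]
    omega
  exact (CodeFP.strLength.comp hgC).congr fun a => hk a

open scoped Classical in
/-- **A separating string for `k⋆` in polynomial time** under `NP ⊆ P` (on codes `⟨1ᴺ, 1ⁱ⟩`).
[cite: AroraBarak2009, Thm. 2.18, Thm. 5.4] -/
theorem exists_wStar (hNP : Nondeterministic.NP ⊆ Classes.P)
    (hrepC : CodeFP (pairE unE strE) strE (fun a => rep a.1 a.2)) :
    ∃ wS : ℕ → ℕ → List Bool, CodeFP (pairE unE unE) strE (fun a => wS a.1 a.2) ∧
      ∀ N i, (wS N i).length ≤ kStar rep N i * kStar rep N i * i ∧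
        wS N i ∈ sepSet rep N i (kStar rep N i) := by
  have hc := CodeFP.fst (pairE unE unE) strE
  have hw := CodeFP.snd (pairE unE unE) strE
  have hk := (codeFP_kStar hNP hrepC).comp hc
  have hsep : CodeFP (pairE (pairE unE unE) strE) bitE
      (fun t => decide (t.2 ∈ sepSet rep t.1.1 t.1.2 (kStar rep t.1.1 t.1.2))) :=
    (codeFP_sep hNP hrepC).comp (hc.fst'.pair (hc.snd'.pair (hk.pair hw)))
  have hkN := CodeFP.natOfUn.comp hk
  have hlen : CodeFP (pairE (pairE unE unE) strE) bitE
      (fun t => decide (t.2.length ≤ kStar rep t.1.1 t.1.2 * kStar rep t.1.1 t.1.2 * t.1.2)) :=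
    CodeFP.natLe.comp ((CodeFP.strNatLength.comp hw).pair (CodeFP.natMul.comp
      ((CodeFP.natMul.comp (hkN.pair hkN)).pair (CodeFP.natOfUn.comp hc.snd'))))
  obtain ⟨g, hgC, hgood, -⟩ := Collapse.search hNP (hlen.and hsep) ((X + 1) ^ 3)
  refine ⟨fun N i => g (N, i), hgC, fun N i => ?_⟩
  obtain ⟨w, hwl, hws⟩ := kStar_mem rep N i
  have hex : ∃ w : List Bool, w.length ≤ ((X + 1) ^ 3 : Polynomial ℕ).eval (pairE unE unE (N, i)).length ∧
      (decide (w.length ≤ kStar rep (N, i).1 (N, i).2 * kStar rep (N, i).1 (N, i).2 * (N, i).2) &&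
        decide (w ∈ sepSet rep (N, i).1 (N, i).2 (kStar rep (N, i).1 (N, i).2))) = true := by
    refine ⟨w, hwl.trans ?_, by simp only [Bool.and_eq_true, decide_eq_true_eq]; exact ⟨hwl, hws⟩⟩
    rw [eval_cube]
    have h1 : i ≤ (pairE unE unE (N, i)).length := by
      simp only [pairE_apply, length_boolPair, length_unE]; omega
    have h2 := kStar_le_succ rep N i
    have h3 : i + 1 ≤ (pairE unE unE (N, i)).length := by
      simp only [pairE_apply, length_boolPair, length_unE]; omega
    exact kki_le_cube (h2.trans h3) h1
  have := (hgood (N, i) hex).2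
  simp only [Bool.and_eq_true, decide_eq_true_eq] at this
  exact this

open scoped Classical in
/-- **A polynomial-time isolating index** (Step 3a). Under `NP ⊆ P`, given the polynomial-time
canonical `rep` and separating strings `w⋆`, some polynomial-time `j(N, y) < k⋆(N, |y|)` isolates
every representative `y`. [cite: AroraBarak2009, Thm. 2.18, Thm. 5.4] -/
theorem exists_jS {wS : ℕ → ℕ → List Bool} (hNP : Nondeterministic.NP ⊆ Classes.P)
    (hrepC : CodeFP (pairE unE strE) strE (fun a => rep a.1 a.2))
    (hwC : CodeFP (pairE unE unE) strE (fun a => wS a.1 a.2))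
    (hwS : ∀ N i, wS N i ∈ CHash.sepSet rep N i (CHash.kStar rep N i)) :
    ∃ jS : ℕ → List Bool → ℕ, CodeFP (pairE unE strE) natE (fun a => jS a.1 a.2) ∧
      ∀ N y, rep N y = y → jS N y < CHash.kStar rep N y.length ∧
        y ∈ CHash.isolSet rep N y.length (CHash.kStar rep N y.length) (wS N y.length) (jS N y) := by
  have hc := CodeFP.fst (pairE unE strE) strE
  have hu := CodeFP.snd (pairE unE strE) strE
  have hN := hc.fst'
  have hy := hc.snd'
  have hi := CodeFP.strLength.comp hy
  have hk := (CHash.codeFP_kStar hNP hrepC).comp (hN.pair hi)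
  have hw := hwC.comp (hN.pair hi)
  have hj := CodeFP.strNatLength.comp hu
  have hiso : CodeFP (pairE (pairE unE strE) strE) bitE (fun t => decide (t.1.2 ∈
      CHash.isolSet rep t.1.1 t.1.2.length (CHash.kStar rep t.1.1 t.1.2.length)
        (wS t.1.1 t.1.2.length) t.2.length)) :=
    (CHash.codeFP_isol hNP hrepC).comp (((hN.pair (hi.pair (hk.pair hw))).pair hy).pair hj)
  have hlt : CodeFP (pairE (pairE unE strE) strE) bitE
      (fun t => decide (t.2.length < CHash.kStar rep t.1.1 t.1.2.length)) :=
    CodeFP.natLt.comp (hj.pair (CodeFP.natOfUn.comp hk))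
  obtain ⟨g, hgC, hgood, -⟩ := Collapse.search hNP (hlt.and hiso) X
  refine ⟨fun N y => (g (N, y)).length, CodeFP.strNatLength.comp hgC, fun N y hy' => ?_⟩
  obtain ⟨j, hj, hjiso⟩ := hwS N y.length y ⟨rfl, hy'⟩
  have hex : ∃ u : List Bool, u.length ≤ X.eval (pairE unE strE (N, y)).length ∧
      (decide (u.length < CHash.kStar rep (N, y).1 (N, y).2.length) && decide ((N, y).2 ∈
        CHash.isolSet rep (N, y).1 (N, y).2.length (CHash.kStar rep (N, y).1 (N, y).2.length)
          (wS (N, y).1 (N, y).2.length) u.length)) = true := by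
    refine ⟨List.replicate j true, ?_, ?_⟩
    · simp only [List.length_replicate, eval_X, pairE_apply, length_boolPair, length_unE,
        CodeFP.strE, id_eq]
      have := CHash.kStar_le_succ rep N y.length
      omega
    · simp only [List.length_replicate, Bool.and_eq_true, decide_eq_true_eq]
      exact ⟨hj, hjiso⟩
  have := (hgood (N, y) hex).2
  simp only [Bool.and_eq_true, decide_eq_true_eq] at this
  exact this

end CHash

end Summit.PneNP.PneNP.Theorems.SoloBlind
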